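import Literature.NumberTheory.LFunctions.WeilArchimedeanMoments
import Literature.NumberTheory.LFunctions.RiemannSiegelStirling
import Mathlib.MeasureTheory.Integral.IntervalIntegral.FundThmCalculus
import Mathlib.Analysis.SpecialFunctions.Log.Deriv

/-!
# `stub_archBathtub` (crux `WeilComb.CombShapePositivity`, line `Sketch`) — siege k8:
direct integral estimate with interval bounds

The registered stub `stub_archBathtub` of the skeleton
`Cruxes/CombShapePositivity/Lines/Sketch.lean` (stmt-RiemannHypothesis-11229): for a Weil test `g` with
`0 < ‖g‖₁` and `2‖g‖₁² ≤ π‖g‖₂²`,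

  `‖g‖₂² (log(‖g‖₂²/(2‖g‖₁²)) − 1) − (21/(5π)) ‖g‖₁² ≤ Re W_∞(g ⋆ g̃)`.

Proof (this attempt's variation: a *direct* pointwise minorant of the archimedean integrand, integrated,
plus *interval bounds* for the digamma weight).  Write `G(t) = |ĝ(1/2+it)|²`, `ρ(t) = Re ψ(1/4 + it/2)`
(`reDigammaQuarter`), `L = ‖g‖₁`, `N = ‖g‖₂²`.

1. `Re W_∞(g ⋆ g̃) = (1/2π) ∫ G ρ − N log π` (`weilArchIntegral_weilConv_weilReflect`,
   `weilConv_weilReflect_apply_zero`).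
2. For every level `T ≥ 0` the pointwise inequality
   `G(t) ρ(t) ≥ ρ(T) G(t) + L² · 1_{[−T,T]}(t) (ρ(t) − ρ(T))`
   holds (`0 ≤ G ≤ L²` by `norm_weilMellin_half_line_le`, `ρ` even and increasing in `|t|`); integrating
   (Plancherel `∫ G = 2πN`) gives `∫ G ρ ≥ L² ∫_{−T}^{T} ρ + ρ(T)(2πN − 2TL²)` (steps 1–2 are
   `re_weilArchTerm_level_ge`), and at `T = πN/L²` the last term vanishes.
3. Interval bounds for `∫_{−T}^{T} ρ = 2∫_0^T ρ` (`T ≥ 2`): on the four half-cells of `[0,2]`,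
   `ρ ≥ ρ(a) ≥ ψ(1/4) + 16a²/(1 + 4a²)` (first term of the vertical series, `sum_digammaTerm_le`), and on
   `[2,T]` the second-order Stirling bound `abs_re_digamma_sub_log_norm_add_re_le` at `w = 1/4 + iu/2` gives
   `ρ(u) ≥ log(u/2) − (9/4) u⁻²`, integrated by the fundamental theorem of calculus. With
   `ψ(1/4) ≥ −4.22745354` this yields `∫_{−T}^{T} ρ ≥ 2T(log(T/2) − 1) − 6.36`, inside the allowed `42/5`.

No named facts; everything is proved.
-/

noncomputable section

-- the sub-problem path `RiemannHypothesis/RiemannHypothesis` (single-conjunct summit, D-0017) duplicates a namespace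
set_option linter.dupNamespace false

open Complex MeasureTheory Set
open scoped Real

namespace Summit.RiemannHypothesis.RiemannHypothesis.Theorems.WeilCombBohrFejerDirectK8

open Literature.NumberTheory.LFunctions
open Literature.Analysis.SpecialFunctions (reDigammaQuarter reDigammaQuarter_mono reDigammaQuarter_even
  reDigammaQuarter_zero continuous_reDigammaQuarter sum_digammaTerm_le digammaTerm digammaNode
  re_digamma_one_quarter_ge)

/-! ## Steps 1–2: the archimedean term of `g ⋆ g̃`, minorised directly at level `T` -/

/-- **Level-`T` estimate for the archimedean term.** For a Weil test `g` and every `T ≥ 0`: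
`(1/2π) (‖g‖₁² ∫_{−T}^{T} ρ + ρ(T) (2π‖g‖₂² − 2T‖g‖₁²)) − ‖g‖₂² log π ≤ Re W_∞(g ⋆ g̃)`.
Step 1: `Re W_∞(g ⋆ g̃) = (1/2π) ∫ G ρ − ‖g‖₂² log π`, `G = |ĝ(1/2+it)|²` (Yoshida's form (2.1):
`weilArchIntegral_weilConv_weilReflect`, `weilConv_weilReflect_apply_zero`). Step 2: integrate the pointwise
inequality `G ρ ≥ ρ(T) G + ‖g‖₁² 1_{[−T,T]} (ρ − ρ(T))` (`0 ≤ G ≤ ‖g‖₁²` by `norm_weilMellin_half_line_le`,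
`ρ` increasing in `|t|`) and use Plancherel `∫ G = 2π‖g‖₂²`. [cite: Yoshida1992, §2 eq. (2.1)] -/
theorem re_weilArchTerm_level_ge {g : ℝ → ℂ} (hg : IsWeilTest g) {T : ℝ} (hT : 0 ≤ T) :
    1 / (2 * Real.pi) * (weilNorm1 g ^ 2 * (∫ u in (-T)..T, reDigammaQuarter u) +
        reDigammaQuarter T * (2 * Real.pi * weilNorm2Sq g - 2 * T * weilNorm1 g ^ 2)) -
        weilNorm2Sq g * Real.log Real.pi ≤
      (weilArchTerm (weilConv g (weilReflect g))).re := by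
  -- Step 1: the archimedean term of the autocorrelation in Yoshida's form
  have hre : (weilArchTerm (weilConv g (weilReflect g))).re =
      1 / (2 * Real.pi) * (∫ t : ℝ, ‖weilMellin g (1 / 2 + t * I)‖ ^ 2 * reDigammaQuarter t) -
        weilNorm2Sq g * Real.log Real.pi := by
    unfold reDigammaQuarter weilArchTerm
    rw [weilArchIntegral_weilConv_weilReflect hg, weilConv_weilReflect_apply_zero]
    have e : ((1 / (2 * Real.pi) : ℂ) * ((∫ t : ℝ, ‖weilMellin g (1 / 2 + t * I)‖ ^ 2 *
          (Complex.digamma (1 / 4 + t / 2 * I)).re : ℝ) : ℂ) -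
          ((∫ t : ℝ, ‖g t‖ ^ 2 : ℝ) : ℂ) * (Real.log Real.pi : ℂ)) =
        ((1 / (2 * Real.pi) * (∫ t : ℝ, ‖weilMellin g (1 / 2 + t * I)‖ ^ 2 *
          (Complex.digamma (1 / 4 + t / 2 * I)).re) - weilNorm2Sq g * Real.log Real.pi : ℝ) : ℂ) := by
      unfold weilNorm2Sq
      push_cast
      ring
    rw [e, Complex.ofReal_re]
  rw [hre]
  -- Step 2: it suffices to minorise `∫ G ρ`
  suffices h : weilNorm1 g ^ 2 * (∫ u in (-T)..T, reDigammaQuarter u) +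
      reDigammaQuarter T * (2 * Real.pi * weilNorm2Sq g - 2 * T * weilNorm1 g ^ 2) ≤
      ∫ t : ℝ, ‖weilMellin g (1 / 2 + t * I)‖ ^ 2 * reDigammaQuarter t by
    have hπ : (0 : ℝ) ≤ 1 / (2 * Real.pi) := by positivity
    linarith [mul_le_mul_of_nonneg_left h hπ]
  set L : ℝ := weilNorm1 g with hL
  set N : ℝ := weilNorm2Sq g with hN
  set G : ℝ → ℝ := fun t => ‖weilMellin g (1 / 2 + t * I)‖ ^ 2 with hG
  set ρ : ℝ → ℝ := reDigammaQuarter with hρ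
  have hGle : ∀ t, G t ≤ L ^ 2 := fun t =>
    pow_le_pow_left₀ (norm_nonneg _) (norm_weilMellin_half_line_le hg t) 2
  have hG0 : ∀ t, 0 ≤ G t := fun t => sq_nonneg _
  have hGint : Integrable G := integrable_norm_sq_weilMellin_half_line hg
  have hGρint : Integrable fun t => G t * ρ t :=
    integrable_norm_sq_weilMellin_mul_reDigammaQuarter hg
  have hPl : ∫ t, G t = 2 * Real.pi * N := integral_norm_sq_weilMellin_half_line hg
  have hρc : Continuous ρ := continuous_reDigammaQuarter
  -- the minorant and the pointwise inequality
  set m : ℝ → ℝ := fun t => ρ T * G t + L ^ 2 * (Icc (-T) T).indicator (fun u => ρ u - ρ T) t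
    with hm
  have hpt : ∀ t, m t ≤ G t * ρ t := by
    intro t
    by_cases ht : t ∈ Icc (-T) T
    · have h1 : ρ t ≤ ρ T :=
        reDigammaQuarter_mono (by rw [abs_of_nonneg hT]; exact abs_le.2 ht)
      simp only [hm, indicator_of_mem ht]
      nlinarith [hGle t, hG0 t, h1]
    · have h1 : ρ T ≤ ρ t := by
        refine reDigammaQuarter_mono ?_
        rw [abs_of_nonneg hT]
        simp only [mem_Icc, not_and_or, not_le] at ht
        rcases ht with ht | ht
        · rw [abs_of_neg (by linarith)]
          linarith
        · rw [abs_of_pos (by linarith)]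
          linarith
      simp only [hm, indicator_of_notMem ht, mul_zero, add_zero]
      nlinarith [hG0 t, h1]
  -- integrability of the minorant
  have hind : Integrable fun t => (Icc (-T) T).indicator (fun u => ρ u - ρ T) t :=
    ((hρc.sub continuous_const).integrableOn_Icc).integrable_indicator measurableSet_Icc
  have hm_int : Integrable m := (hGint.const_mul (ρ T)).add (hind.const_mul (L ^ 2))
  -- its integral
  have hIcc : ∫ t in Icc (-T) T, (ρ t - ρ T) = (∫ u in (-T)..T, ρ u) - 2 * T * ρ T := by
    rw [integral_sub hρc.integrableOn_Icc (continuous_const.integrableOn_Icc), setIntegral_const,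
      Real.volume_real_Icc_of_le (by linarith), smul_eq_mul, intervalIntegral.integral_of_le (by linarith),
      integral_Icc_eq_integral_Ioc]
    ring
  have hm_integral : ∫ t, m t = ρ T * (2 * Real.pi * N) +
      L ^ 2 * ((∫ u in (-T)..T, ρ u) - 2 * T * ρ T) := by
    simp only [hm]
    rw [integral_add (hGint.const_mul _) (hind.const_mul _), integral_const_mul, integral_const_mul,
      hPl, integral_indicator measurableSet_Icc, hIcc]
  have hmono := integral_mono hm_int hGρint hpt
  rw [hm_integral] at hmono
  linarith

/-! ## Step 3: interval bounds for the digamma weight -/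

/-- **Cell bound.** On a cell `[a, b] ⊆ [0, ∞)`, `ρ ≥ ρ(a)`, hence `(b − a) c ≤ ∫_a^b ρ` for every
`c ≤ ρ(a)`. [folklore] -/
theorem cell_ge {a b c : ℝ} (ha : 0 ≤ a) (hab : a ≤ b) (hc : c ≤ reDigammaQuarter a) :
    (b - a) * c ≤ ∫ u in a..b, reDigammaQuarter u := by
  have h := intervalIntegral.integral_mono_on (f := fun _ => c) (g := reDigammaQuarter) (μ := volume)
    hab intervalIntegrable_const (continuous_reDigammaQuarter.intervalIntegrable _ _) (fun u hu => ?_)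
  · rwa [intervalIntegral.integral_const, smul_eq_mul] at h
  · exact hc.trans (reDigammaQuarter_mono (by
      rw [abs_of_nonneg ha, abs_of_nonneg (ha.trans hu.1)]
      exact hu.1))

/-- **Node bound** (first term of the vertical series): `ρ(a) ≥ ψ(1/4) + 2a²/(l₀(l₀² + a²))`, `l₀ = 1/2`. [folklore] -/
theorem node_ge (a : ℝ) :
    reDigammaQuarter 0 + 2 * a ^ 2 / ((1 / 2) * ((1 / 2) ^ 2 + a ^ 2)) ≤ reDigammaQuarter a := by
  have h := sum_digammaTerm_le 1 a
  rw [Finset.sum_range_one] at h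
  have e : digammaTerm (digammaNode 0) a = 2 * a ^ 2 / ((1 / 2) * ((1 / 2) ^ 2 + a ^ 2)) := by
    simp [digammaTerm, digammaNode]
  linarith [e ▸ h]

/-- `∫_0^2 ρ ≥ 2ψ(1/4) + 22/5` from the four half-cells of `[0, 2]` (node values `ψ(1/4) + 0, 2, 16/5, 18/5`). [folklore] -/
theorem integral_zero_two_ge :
    2 * reDigammaQuarter 0 + 22 / 5 ≤ ∫ u in (0 : ℝ)..2, reDigammaQuarter u := by
  have hi : ∀ a b : ℝ, IntervalIntegrable reDigammaQuarter volume a b := fun a b =>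
    continuous_reDigammaQuarter.intervalIntegrable a b
  have h0 := node_ge (1 / 2)
  have h1 := node_ge 1
  have h2 := node_ge (3 / 2)
  norm_num at h0 h1 h2
  have c0 := cell_ge (a := 0) (b := 1 / 2) (c := reDigammaQuarter 0) le_rfl (by norm_num) le_rfl
  have c1 := cell_ge (a := 1 / 2) (b := 1) (c := reDigammaQuarter 0 + 2) (by norm_num) (by norm_num) h0
  have c2 := cell_ge (a := 1) (b := 3 / 2) (c := reDigammaQuarter 0 + 16 / 5) (by norm_num) (by norm_num) h1
  have c3 := cell_ge (a := 3 / 2) (b := 2) (c := reDigammaQuarter 0 + 18 / 5) (by norm_num) (by norm_num) h2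
  have s1 := intervalIntegral.integral_add_adjacent_intervals (hi 0 (1 / 2)) (hi (1 / 2) 1)
  have s2 := intervalIntegral.integral_add_adjacent_intervals (hi 0 1) (hi 1 (3 / 2))
  have s3 := intervalIntegral.integral_add_adjacent_intervals (hi 0 (3 / 2)) (hi (3 / 2) 2)
  norm_num at c0 c1 c2 c3
  linarith

/-- **Tail minorant** from the second-order Stirling bound at `w = 1/4 + iu/2` (`u ≥ 2`):
`ρ(u) ≥ log(u/2) − (9/4) u⁻²` (`log ‖w‖ ≥ log(u/2)`, `Re 1/(2w) = 2/(1+4u²) ≤ 1/(2u²)`, remainder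
`4/(3u³) + π/(3u²) ≤ (2/3 + 21/20) u⁻²`). [folklore] -/
theorem tail_ge {u : ℝ} (hu : 2 ≤ u) :
    Real.log (u / 2) - 9 / 4 * (u ^ 2)⁻¹ ≤ reDigammaQuarter u := by
  have hu0 : 0 < u := by linarith
  set w : ℂ := 1 / 4 + u / 2 * I with hw
  have hre : w.re = 1 / 4 := by simp [hw]
  have him : w.im = u / 2 := by simp [hw]
  have h := Literature.NumberTheory.LFunctions.Complex.abs_re_digamma_sub_log_norm_add_re_le
    (w := w) (by rw [hre]; norm_num) (by rw [him]; positivity)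
  rw [him] at h
  have hρ : reDigammaQuarter u = (Complex.digamma w).re := by simp [reDigammaQuarter, hw]
  -- `log ‖w‖ ≥ log (u/2)`
  have hnorm : u / 2 ≤ ‖w‖ := by
    have := Complex.abs_im_le_norm w
    rwa [him, abs_of_pos (by positivity)] at this
  have hlog : Real.log (u / 2) ≤ Real.log ‖w‖ := Real.log_le_log (by positivity) hnorm
  -- `Re 1/(2w) ≤ 1/(2u²)`
  have hX : 0 < (u ^ 2)⁻¹ := by positivity
  have hre2 : (1 / (2 * w)).re ≤ 1 / 2 * (u ^ 2)⁻¹ := by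
    have e : (1 / (2 * w)).re = (1 / 2) / (1 / 2 * (1 / 2) + u * u) := by
      have e2 : (2 : ℂ) * w = ((1 / 2 : ℝ) : ℂ) + (u : ℂ) * I := by
        rw [hw]; push_cast; ring
      rw [e2, one_div, Complex.inv_re, Complex.normSq_apply]
      simp
    rw [e]
    rw [div_le_iff₀ (by positivity)]
    have : 1 / 2 * (u ^ 2)⁻¹ * (1 / 2 * (1 / 2) + u * u) = 1 / 2 + 1 / 8 * (u ^ 2)⁻¹ := by
      field_simp
      ring
    rw [this]
    linarith
  -- the remainder
  have hE1 : 1 / (6 * |u / 2| ^ 3) ≤ 2 / 3 * (u ^ 2)⁻¹ := by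
    rw [abs_of_pos (by positivity)]
    rw [div_le_iff₀ (by positivity)]
    have : 2 / 3 * (u ^ 2)⁻¹ * (6 * (u / 2) ^ 3) = u / 2 := by
      field_simp
      ring
    rw [this]
    linarith
  have hE2 : Real.pi / (12 * (u / 2) ^ 2) ≤ 21 / 20 * (u ^ 2)⁻¹ := by
    have hπ := Real.pi_lt_d2
    rw [div_le_iff₀ (by positivity)]
    have : 21 / 20 * (u ^ 2)⁻¹ * (12 * (u / 2) ^ 2) = 63 / 20 := by
      field_simp
      ring
    rw [this]
    linarith
  have h' := (abs_le.1 h).1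
  rw [hρ]
  nlinarith [hX]

/-- The primitive `F(u) = u log(u/2) − u + (9/4) u⁻¹` of the tail minorant. [folklore] -/
theorem hasDerivAt_tailPrim {u : ℝ} (hu : 0 < u) :
    HasDerivAt (fun u : ℝ => u * Real.log (u / 2) - u + 9 / 4 * u⁻¹)
      (Real.log (u / 2) - 9 / 4 * (u ^ 2)⁻¹) u := by
  have h1 : HasDerivAt (fun u : ℝ => Real.log (u / 2)) ((1 / 2) / (u / 2)) u := by
    have := ((hasDerivAt_id u).div_const 2).log (by simp; exact hu.ne')
    simpa using this
  have h2 : HasDerivAt (fun u : ℝ => u * Real.log (u / 2)) (1 * Real.log (u / 2) + u * ((1 / 2) / (u / 2))) u :=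
    (hasDerivAt_id' u).mul h1
  have h3 : HasDerivAt (fun u : ℝ => u⁻¹) (-(u ^ 2)⁻¹) u := hasDerivAt_inv hu.ne'
  have h4 := (h2.sub (hasDerivAt_id' u)).add (h3.const_mul (9 / 4))
  refine h4.congr_deriv ?_
  have e : u * ((1 / 2) / (u / 2)) = 1 := by
    field_simp
  rw [e]
  ring

/-- **Tail bound**: `∫_2^T ρ ≥ T log(T/2) − T + 7/8` for `T ≥ 2` (FTC for the minorant of `tail_ge`;
`F(T) − F(2) = T log(T/2) − T + 9/(4T) + 2 − 9/8`). [folklore] -/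
theorem integral_two_ge {T : ℝ} (hT : 2 ≤ T) :
    T * Real.log (T / 2) - T + 7 / 8 ≤ ∫ u in (2 : ℝ)..T, reDigammaQuarter u := by
  set f : ℝ → ℝ := fun u => Real.log (u / 2) - 9 / 4 * (u ^ 2)⁻¹ with hf
  set F : ℝ → ℝ := fun u => u * Real.log (u / 2) - u + 9 / 4 * u⁻¹ with hF
  have hderiv : ∀ x ∈ uIcc (2 : ℝ) T, HasDerivAt F (f x) x := by
    intro x hx
    rw [uIcc_of_le hT] at hx
    exact hasDerivAt_tailPrim (by linarith [hx.1])
  have hcont : ContinuousOn f (uIcc (2 : ℝ) T) := by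
    intro x hx
    rw [uIcc_of_le hT] at hx
    have hx0 : 0 < x := by linarith [hx.1]
    refine ContinuousAt.continuousWithinAt ?_
    have c1 : ContinuousAt (fun u : ℝ => Real.log (u / 2)) x :=
      (continuousAt_id.div_const 2).log (by simp; exact hx0.ne')
    have c2 : ContinuousAt (fun u : ℝ => (u ^ 2)⁻¹) x :=
      (continuousAt_id.pow 2).inv₀ (by simp; exact hx0.ne')
    exact c1.sub (continuousAt_const.mul c2)
  have hfi : IntervalIntegrable f volume 2 T := hcont.intervalIntegrable
  have hFTC : ∫ u in (2 : ℝ)..T, f u = F T - F 2 := intervalIntegral.integral_eq_sub_of_hasDerivAt hderiv hfi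
  have hmono : ∫ u in (2 : ℝ)..T, f u ≤ ∫ u in (2 : ℝ)..T, reDigammaQuarter u :=
    intervalIntegral.integral_mono_on hT hfi (continuous_reDigammaQuarter.intervalIntegrable _ _)
      fun u hu => tail_ge hu.1
  rw [hFTC] at hmono
  have hF2 : F 2 = -2 + 9 / 8 := by
    simp only [hF]
    norm_num
  have hFT : F T = T * Real.log (T / 2) - T + 9 / 4 * T⁻¹ := rfl
  have hpos : 0 ≤ 9 / 4 * T⁻¹ := by
    have : 0 < T := by linarith
    positivity
  linarith

/-- **Half-line bound**: `∫_0^T ρ ≥ T log(T/2) − T − 3.17990708` for `T ≥ 2`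
(cells on `[0,2]`, tail on `[2,T]`, `ψ(1/4) ≥ −4.22745354`). [folklore] -/
theorem integral_zero_ge {T : ℝ} (hT : 2 ≤ T) :
    T * Real.log (T / 2) - T - 3.17990708 ≤ ∫ u in (0 : ℝ)..T, reDigammaQuarter u := by
  have hi : ∀ a b : ℝ, IntervalIntegrable reDigammaQuarter volume a b := fun a b =>
    continuous_reDigammaQuarter.intervalIntegrable a b
  have s := intervalIntegral.integral_add_adjacent_intervals (hi 0 2) (hi 2 T)
  have h1 := integral_zero_two_ge
  have h2 := integral_two_ge hT
  have h3 := re_digamma_one_quarter_ge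
  rw [← reDigammaQuarter_zero] at h3
  linarith

/-- **Symmetric bound**: `∫_{−T}^{T} ρ ≥ 2T(log(T/2) − 1) − 6.35981416` for `T ≥ 2` (evenness of `ρ` and
`integral_zero_ge`; the stub only needs the constant `42/5`). [folklore] -/
theorem integral_symm_ge {T : ℝ} (hT : 2 ≤ T) :
    2 * T * (Real.log (T / 2) - 1) - 6.35981416 ≤ ∫ u in (-T)..T, reDigammaQuarter u := by
  have hi : ∀ a b : ℝ, IntervalIntegrable reDigammaQuarter volume a b := fun a b =>
    continuous_reDigammaQuarter.intervalIntegrable a b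
  have s := intervalIntegral.integral_add_adjacent_intervals (hi (-T) 0) (hi 0 T)
  have hneg : ∫ u in (-T)..0, reDigammaQuarter u = ∫ u in (0 : ℝ)..T, reDigammaQuarter u := by
    have h := intervalIntegral.integral_comp_neg (a := 0) (b := T) (f := reDigammaQuarter)
    simp only [reDigammaQuarter_even, neg_zero] at h
    exact h.symm
  have h1 := integral_zero_ge hT
  linarith

/-! ## The stub -/

/-- **Stub S3 of line `Sketch` (`stub_archBathtub`) — bathtub bound for the archimedean diagonal of a Weil
test.** For a Weil test `g` with `0 < ‖g‖₁` and `2‖g‖₁² ≤ π‖g‖₂²`: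
`‖g‖₂² (log(‖g‖₂²/(2‖g‖₁²)) − 1) − (21/(5π)) ‖g‖₁² ≤ Re W_∞(g ⋆ g̃)`.
Proof: the level estimate `re_weilArchTerm_level_ge` at `T = π‖g‖₂²/‖g‖₁² ≥ 2`, where the `ρ(T)`-term
vanishes (`2T‖g‖₁² = 2π‖g‖₂²`), then `integral_symm_ge` and `(1/2π)‖g‖₁² · 2T = ‖g‖₂²`,
`log(T/2) = log π + log(‖g‖₂²/(2‖g‖₁²))`. [folklore] -/
theorem stub_archBathtub : ∀ g : ℝ → ℂ, IsWeilTest g → 0 < weilNorm1 g →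
    2 * weilNorm1 g ^ 2 ≤ Real.pi * weilNorm2Sq g →
    weilNorm2Sq g * (Real.log (weilNorm2Sq g / (2 * weilNorm1 g ^ 2)) - 1) -
        21 / (5 * Real.pi) * weilNorm1 g ^ 2 ≤
      (weilArchTerm (weilConv g (weilReflect g))).re := by
  intro g hg hL hcond
  set L : ℝ := weilNorm1 g with hLdef
  set N : ℝ := weilNorm2Sq g with hNdef
  have hπ : 0 < Real.pi := Real.pi_pos
  have hL2 : 0 < L ^ 2 := by positivity
  have hN : 0 < N := by
    by_contra h
    rw [not_lt] at h
    nlinarith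
  set T : ℝ := Real.pi * N / L ^ 2 with hTdef
  have hT2 : 2 ≤ T := by
    rw [hTdef, le_div_iff₀ hL2]
    linarith
  have hT0 : 0 ≤ T := by linarith
  have hTL : 2 * T * L ^ 2 = 2 * Real.pi * N := by
    rw [hTdef]
    field_simp
  -- Steps 1–2 at the level `T = πN/L²`: the `ρ(T)`-term vanishes
  have hlev := re_weilArchTerm_level_ge hg hT0
  rw [← hLdef, ← hNdef] at hlev
  have hvan : reDigammaQuarter T * (2 * Real.pi * N - 2 * T * L ^ 2) = 0 := by
    rw [hTL, sub_self, mul_zero]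
  rw [hvan, add_zero] at hlev
  -- Step 3: `R = ∫_{−T}^{T} ρ ≥ 2T(log(T/2) − 1) − 42/5`
  set R := ∫ u in (-T)..T, reDigammaQuarter u with hR
  have hsym : 2 * T * (Real.log (T / 2) - 1) - 42 / 5 ≤ R := by
    have := integral_symm_ge hT2
    linarith
  have h1 : 1 / (2 * Real.pi) * (L ^ 2 * (2 * T * (Real.log (T / 2) - 1) - 42 / 5)) ≤
      1 / (2 * Real.pi) * (L ^ 2 * R) :=
    mul_le_mul_of_nonneg_left (mul_le_mul_of_nonneg_left hsym hL2.le) (by positivity)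
  -- the algebra: `(1/2π) L² 2T = N`, `log(T/2) = log π + log(N/(2L²))`
  have hlogT : Real.log (T / 2) = Real.log Real.pi + Real.log (N / (2 * L ^ 2)) := by
    rw [← Real.log_mul hπ.ne' (by positivity)]
    congr 1
    rw [hTdef]
    field_simp
  have key : 1 / (2 * Real.pi) * (L ^ 2 * (2 * T * (Real.log (T / 2) - 1) - 42 / 5)) =
      N * (Real.log (N / (2 * L ^ 2)) - 1) + N * Real.log Real.pi - 21 / (5 * Real.pi) * L ^ 2 := by
    rw [hlogT, hTdef]
    field_simp
    ring
  rw [key] at h1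
  linarith

end Summit.RiemannHypothesis.RiemannHypothesis.Theorems.WeilCombBohrFejerDirectK8

end
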